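import Summits.Ventures.CertifiedManyBodySolver.Theorems.TcThermcert1SeamTwistInputs
import Literature.MathematicalPhysics.QuantumLattice.FermionLiebRobinson
import Mathlib
import HarnessLib

/-!
# Sector, parity and locality bookkeeping for the quantum-belief-propagation port (stub B of line `gauge_qbp_far_seam`, part 7a)

Helper module for route `TcThermcert1`, cruxes K1′ `ThermalStiffnessCeilingU8b8_le_7o44` (item `stmt-Ventures-24560`) and
K1 `ThermalStiffnessCeilingU8b10_le_1o8` (item `stmt-Ventures-26381`), line
`Cruxes/ThermalStiffnessCeilingU8b10_le_1o8/Lines/gauge_qbp_far_seam.lean` v1.3, registered stub B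
(`stub_farCutCurrent_of_clustering`, the port of Capel–Moscolari–Teufel–Wessel, arXiv:2310.09182, Prop. 6 + Thm. 14). Parts 1–6
(`TcThermcert1Qbp{OrderedExponential,Generator,GibbsDerivative,Weight,LocalPerturbation,Localisation}`) are model-free; this part
supplies the MODEL-SIDE bookkeeping their hypotheses ask for, stated over the tree's literal operators:

* §1 SECTORS. A matrix commuting with the two diagonal counters `diag(#↑)`, `diag(#↓)` conserves `(N↑, N↓)`
  (`preservesSectors_of_commute_upDown`, converse of the tree's `PreservesSectors.commute_diagonal`); hence the
  subalgebra clause of `exists_qbp_conjugation(_pair)` («`E ∈ S` for every subalgebra `S ∋ H, V`») makes the QBP intertwiners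
  sector preserving (`preservesSectors_of_forall_subalgebra_mem`), and `PreservesSectors` implies the entrywise shape
  `SectorPreserving L δ` used by the line and by part 5 (`sectorPreserving_of_preservesSectors`, any `(N, S^z = 0)` sector).
* §2 PARITY / LOCALITY. The even CAR algebra of a region is closed under the adjoint (`conjTranspose_mem_carEvenSubalgebra`), so the
  test observable `ẼᴴẼ` of the localised intertwiner is even and supported in the collar; the seam operator, the bond currents and
  partial sums of Hubbard terms lie in the even algebras of their supports (`seamTwist_mem_carEvenSubalgebra`,
  `farBond_mem_carEvenSubalgebra`, `sum_hubbardTermOp_mem_carEvenSubalgebra`) and even elements of disjoint regions commute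
  (`commute_of_mem_carEvenSubalgebra_orbSet`); partial sums of Hubbard terms are Hermitian and sector preserving.
* §3 SIZES. `‖c†_i c_j‖ ≤ 1`, the bond current has norm `≤ 4`, and `‖seamTwist L θ‖ ≤ 4L|θ|` — the flux-proportional size
  entering every `e^{O(β‖V_φ‖)}` of the port; and the flux-free torus Hamiltonian is the sum of the tree's local terms
  `hubbardTermOp (fermionTorusGraph 2 L) 1 U 0` (`hubbardTorusTT'Flux_zero_zero_eq_sum_hubbardTermOp`), the presentation the
  Lieb–Robinson input (part 7b) is stated over.
Theorems only; nothing about superconductivity in the Hubbard model is proved by anything in this file.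
-/

noncomputable section

open scoped ComplexOrder ComplexConjugate
open Matrix Finset
open Literature.MathematicalPhysics.QuantumLattice

namespace Summit.Ventures.CertifiedManyBodySolver.Theorems.TcThermcert1.GaugeQbpFarSeam

/-! ## §1 Sector bookkeeping -/

section Sectors

variable {Λ : Type*} [LinearOrder Λ] [Fintype Λ]

/-- A matrix commuting with `diag(#↑)` and `diag(#↓)` conserves `N↑` and `N↓` (converse of the tree's
`PreservesSectors.commute_diagonal`). [cite: LiebPRL1989, Remark (2)] -/
theorem preservesSectors_of_commute_upDown {M : Matrix (Finset (Orb Λ)) (Finset (Orb Λ)) ℂ}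
    (hu : Commute M (Matrix.diagonal fun s : Finset (Orb Λ) => ((upPart s).card : ℂ)))
    (hd : Commute M (Matrix.diagonal fun s : Finset (Orb Λ) => ((downPart s).card : ℂ))) :
    PreservesSectors M := by
  intro s s' hM
  have key : ∀ f : Finset (Orb Λ) → ℕ, Commute M (Matrix.diagonal fun s => (f s : ℂ)) → f s = f s' := by
    intro f hf
    have h := congr_fun (congr_fun hf.eq s) s'
    rw [mul_diagonal, diagonal_mul] at h
    have h' : ((f s' : ℂ) - f s) * M s s' = 0 := by rw [sub_mul, ← h]; ring
    rcases mul_eq_zero.1 h' with h0 | h0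
    · exact_mod_cast (sub_eq_zero.1 h0).symm
    · exact absurd h0 hM
  exact ⟨key _ hu, key _ hd⟩

/-- **The subalgebra clause makes QBP intertwiners sector preserving.** If `E` lies in every subalgebra containing `H` and `V`,
and `H`, `V` conserve `(N↑, N↓)`, then so does `E` (take the centralizer of the two diagonal counters).
[cite: LiebPRL1989, Remark (2)] -/
theorem preservesSectors_of_forall_subalgebra_mem {H V E : Matrix (Finset (Orb Λ)) (Finset (Orb Λ)) ℂ}
    (hE : ∀ S : Subalgebra ℂ (Matrix (Finset (Orb Λ)) (Finset (Orb Λ)) ℂ), H ∈ S → V ∈ S → E ∈ S)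
    (hH : PreservesSectors H) (hV : PreservesSectors V) : PreservesSectors E := by
  set D : Set (Matrix (Finset (Orb Λ)) (Finset (Orb Λ)) ℂ) :=
    {Matrix.diagonal fun s : Finset (Orb Λ) => ((upPart s).card : ℂ),
      Matrix.diagonal fun s : Finset (Orb Λ) => ((downPart s).card : ℂ)} with hD
  have hmem : ∀ M : Matrix (Finset (Orb Λ)) (Finset (Orb Λ)) ℂ, PreservesSectors M →
      M ∈ Subalgebra.centralizer ℂ D := by
    intro M hM
    rw [Subalgebra.mem_centralizer_iff]
    intro g hg
    rcases hg with rfl | rfl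
    · exact (hM.commute_diagonal fun x _ => (x : ℂ)).symm.eq
    · exact (hM.commute_diagonal fun _ y => (y : ℂ)).symm.eq
  have hEc := hE _ (hmem H hH) (hmem V hV)
  rw [Subalgebra.mem_centralizer_iff] at hEc
  refine preservesSectors_of_commute_upDown ?_ ?_
  · exact (Commute.symm (hEc _ (by simp [hD]) : Commute _ E))
  · exact (Commute.symm (hEc _ (by simp [hD]) : Commute _ E))

/-- **`PreservesSectors` in the entrywise shape of the line's `SectorPreserving L δ`**: a matrix conserving `(N↑, N↓)` has no
entry between the `(N = 2M, S^z = 0)` coordinate sector and its complement, in either direction. [cite: LiebPRL1989, Remark (2)] -/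
theorem sectorPreserving_of_preservesSectors {X : Matrix (Finset (Orb Λ)) (Finset (Orb Λ)) ℂ}
    (hX : PreservesSectors X) (M : ℕ) :
    ∀ s t : Finset (Orb Λ),
      (s.card = 2 * M ∧ 2 * (s.filter fun i => (ofLex i).2 = 0).card = 2 * M) →
      ¬ (t.card = 2 * M ∧ 2 * (t.filter fun i => (ofLex i).2 = 0).card = 2 * M) →
      X s t = 0 ∧ X t s = 0 := by
  -- the spin-`0` orbitals of a configuration are its up electrons
  have hup : ∀ s : Finset (Orb Λ), (s.filter fun i => (ofLex i).2 = 0).card = (upPart s).card := by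
    intro s
    rw [show (s.filter fun i => (ofLex i).2 = 0) = (upPart s).image (fun x => orb x 0) from ?_,
      Finset.card_image_of_injective _ (fun x y h => (orb_inj.1 h).1)]
    ext i
    simp only [Finset.mem_filter, Finset.mem_image, mem_upPart]
    constructor
    · rintro ⟨hi, h0⟩
      refine ⟨(ofLex i).1, ?_, ?_⟩ <;>
      · have : orb (ofLex i).1 0 = i := by rw [← h0]; exact toLex_ofLex i
        simp [this, hi]
    · rintro ⟨x, hx, rfl⟩
      exact ⟨hx, rfl⟩
  have hiff : ∀ s : Finset (Orb Λ), (s.card = 2 * M ∧ 2 * (s.filter fun i => (ofLex i).2 = 0).card = 2 * M) ↔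
      ((upPart s).card = M ∧ (downPart s).card = M) := by
    intro s
    rw [hup, card_eq_upPart_add_downPart s]
    omega
  intro s t hs ht
  rw [hiff] at hs ht
  constructor
  · by_contra h
    exact ht ⟨(hX s t h).1 ▸ hs.1, (hX s t h).2 ▸ hs.2⟩
  · by_contra h
    exact ht ⟨(hX t s h).1.symm ▸ hs.1, (hX t s h).2.symm ▸ hs.2⟩

variable (G : SimpleGraph Λ)

/-- Each local Hubbard term conserves `(N↑, N↓)`. [cite: LiebPRL1989, proof of Theorem 1] -/
theorem preservesSectors_hubbardTermOp (t U μ : ℝ) (Z : HubbardIdx G) :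
    PreservesSectors (hubbardTermOp G t U μ Z) := by
  cases Z with
  | inl p =>
    exact ((PreservesSectors.sum fun σ _ =>
      (LiebThm1.preservesSectors_hopping _ _ σ).add (LiebThm1.preservesSectors_hopping _ _ σ))).smul _
  | inr x =>
    simp only [hubbardTermOp, sub_eq_add_neg, ← neg_smul]
    exact (((LiebThm1.preservesSectors_numberOp x 0).mul (LiebThm1.preservesSectors_numberOp x 1)).smul _).add
      (((LiebThm1.preservesSectors_numberOp x 0).add (LiebThm1.preservesSectors_numberOp x 1)).smul _)

/-- Partial sums of local Hubbard terms (restricted Hamiltonians) conserve `(N↑, N↓)`. [cite: LiebPRL1989, proof of Theorem 1] -/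
theorem preservesSectors_sum_hubbardTermOp (t U μ : ℝ) (T : Finset (HubbardIdx G)) :
    PreservesSectors (∑ Z ∈ T, hubbardTermOp G t U μ Z) :=
  PreservesSectors.sum fun Z _ => preservesSectors_hubbardTermOp G t U μ Z

/-- Partial sums of local Hubbard terms are Hermitian. [folklore] -/
theorem isHermitian_sum_hubbardTermOp (t U μ : ℝ) (T : Finset (HubbardIdx G)) :
    (∑ Z ∈ T, hubbardTermOp G t U μ Z).IsHermitian := by
  classical
  induction T using Finset.induction_on with
  | empty => rw [sum_empty]; exact isHermitian_zero
  | @insert Z T hZ ih => rw [sum_insert hZ]; exact (isHermitian_hubbardTermOp G t U μ Z).add ih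

end Sectors

/-! ## §2 Parity and locality bookkeeping -/

section Parity

variable {ι : Type*} [LinearOrder ι] [Fintype ι]

/-- **The even CAR algebra of a region is closed under the adjoint** (its generators `c♯_i c♯_j`, `i, j ∈ S`, go to generators).
[cite: BratteliRobinsonII1997, §5.2.2 (even subalgebra)] -/
theorem conjTranspose_mem_carEvenSubalgebra {S : Finset ι} {A : Matrix (Finset ι) (Finset ι) ℂ}
    (hA : A ∈ carEvenSubalgebra S) : Aᴴ ∈ carEvenSubalgebra S := by
  have hl : ∀ l : JWLetter ι, star (letterOp l) = letterOp (l.1, !l.2) := by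
    rintro ⟨i, b⟩
    cases b
    · simp [letterOp, star_eq_conjTranspose, annihilation_conjTranspose]
    · simp only [letterOp, if_true, Bool.not_true, star_eq_conjTranspose]
      rw [← annihilation_conjTranspose, conjTranspose_conjTranspose]
      rfl
  have hgen : star (carEvenGenerators S) = carEvenGenerators S := by
    have hsub : ∀ M : Matrix (Finset ι) (Finset ι) ℂ, M ∈ carEvenGenerators S → star M ∈ carEvenGenerators S := by
      rintro M ⟨l, l', hl1, hl2, rfl⟩
      refine ⟨(l'.1, !l'.2), (l.1, !l.2), hl2, hl1, ?_⟩
      rw [star_mul, hl, hl]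
    ext M
    rw [Set.mem_star]
    exact ⟨fun h => by simpa using hsub _ h, fun h => hsub _ h⟩
  have hstar : star (carEvenSubalgebra S) = carEvenSubalgebra S := by
    unfold carEvenSubalgebra
    rw [Subalgebra.star_adjoin_comm, hgen]
  rw [← star_eq_conjTranspose, ← hstar]
  exact Subalgebra.mem_star_iff _ _ |>.2 (by simpa using hA)

/-- `AᴴA` is even and supported in `S` whenever `A` is. [cite: BratteliRobinsonII1997, §5.2.2 (even subalgebra)] -/
theorem conjTranspose_mul_self_mem_carEvenSubalgebra {S : Finset ι} {A : Matrix (Finset ι) (Finset ι) ℂ}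
    (hA : A ∈ carEvenSubalgebra S) : Aᴴ * A ∈ carEvenSubalgebra S :=
  Subalgebra.mul_mem _ (conjTranspose_mem_carEvenSubalgebra hA) hA

variable {Λ : Type*} [LinearOrder Λ] [Fintype Λ]

/-- A spin-diagonal or spin-flip hopping between sites of `X` is even and supported in `X`. [folklore] -/
theorem hopping_mem_carEvenSubalgebra_orbSet {X : Finset Λ} {x y : Λ} (hx : x ∈ X) (hy : y ∈ X) (σ τ : Fin 2) :
    creation (orb x σ) * annihilation (orb y τ) ∈ carEvenSubalgebra (orbSet X) :=
  creation_mul_annihilation_mem_carEvenSubalgebra (orb_mem_orbSet hx σ) (orb_mem_orbSet hy τ)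

/-- A triple sum of weighted hoppings between sites of `X` is even and supported in `X` (the shape of `seamTwist_eq`).
[folklore] -/
theorem sum₃_smul_hopping_mem_carEvenSubalgebra {α β γ : Type*} [Fintype α] [Fintype β] [Fintype γ]
    (c : α → β → γ → ℂ) (a b : α → β → γ → Λ) (σ τ : α → β → γ → Fin 2) {X : Finset Λ}
    (ha : ∀ i j k, a i j k ∈ X) (hb : ∀ i j k, b i j k ∈ X) :
    (∑ i, ∑ j, ∑ k, c i j k • (creation (orb (a i j k) (σ i j k)) * annihilation (orb (b i j k) (τ i j k))) :
        Matrix (Finset (Orb Λ)) (Finset (Orb Λ)) ℂ) ∈ carEvenSubalgebra (orbSet X) :=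
  Subalgebra.sum_mem _ fun i _ => Subalgebra.sum_mem _ fun j _ => Subalgebra.sum_mem _ fun k _ =>
    Subalgebra.smul_mem _ (hopping_mem_carEvenSubalgebra_orbSet (ha i j k) (hb i j k) _ _) _

/-- **Even elements of disjoint regions commute** (site form of the tree's graded commutativity). [cite: BratteliRobinsonII1997, §5.2.2] -/
theorem commute_of_mem_carEvenSubalgebra_orbSet {X Y : Finset Λ} {A B : Matrix (Finset (Orb Λ)) (Finset (Orb Λ)) ℂ}
    (hA : A ∈ carEvenSubalgebra (orbSet X)) (hB : B ∈ carEvenSubalgebra (orbSet Y)) (h : Disjoint X Y) :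
    Commute A B :=
  commute_of_mem_carEvenSubalgebra hA (carEvenSubalgebra_le_carSubalgebra _ hB) (disjoint_orbSet h)

/-- The plain bond current `Σ_σ(−i c†_{aσ} c_{bσ} + i c†_{bσ} c_{aσ})` through a bond `b–a` is even and supported on any region
containing its two sites. [folklore] -/
theorem farBond_mem_carEvenSubalgebra {X : Finset Λ} {a b : Λ} (ha : a ∈ X) (hb : b ∈ X) :
    (∑ σ : Fin 2, ((-Complex.I) • (creation (orb a σ) * annihilation (orb b σ)) +
        Complex.I • (creation (orb b σ) * annihilation (orb a σ))) : Matrix (Finset (Orb Λ)) (Finset (Orb Λ)) ℂ) ∈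
      carEvenSubalgebra (orbSet X) :=
  Subalgebra.sum_mem _ fun σ _ => Subalgebra.add_mem _
    (Subalgebra.smul_mem _ (hopping_mem_carEvenSubalgebra_orbSet ha hb σ σ) _)
    (Subalgebra.smul_mem _ (hopping_mem_carEvenSubalgebra_orbSet hb ha σ σ) _)

variable (G : SimpleGraph Λ)

/-- **A restricted Hamiltonian is even and supported in its region**: a sum of local Hubbard terms whose supports lie in `X`
belongs to the even CAR algebra of `X`. [folklore] -/
theorem sum_hubbardTermOp_mem_carEvenSubalgebra (t U μ : ℝ) {X : Finset Λ} {T : Finset (HubbardIdx G)}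
    (hT : ∀ Z ∈ T, hubbardTermSupp G Z ⊆ X) :
    ∑ Z ∈ T, hubbardTermOp G t U μ Z ∈ carEvenSubalgebra (orbSet X) :=
  Subalgebra.sum_mem _ fun Z hZ =>
    carEvenSubalgebra_mono (fun _ hk => mem_orbSet.2 (hT Z hZ (mem_orbSet.1 hk)))
      (hubbardTermOp_mem_carEvenSubalgebra G t U μ Z)

/-- A local Hubbard term supported away from `Y` commutes with every even element of `Y` (e.g. a far bond current).
[cite: BratteliRobinsonII1997, §5.2.2] -/
theorem commute_hubbardTermOp_of_mem_carEvenSubalgebra (t U μ : ℝ) (Z : HubbardIdx G) {Y : Finset Λ}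
    {B : Matrix (Finset (Orb Λ)) (Finset (Orb Λ)) ℂ} (hB : B ∈ carEvenSubalgebra (orbSet Y))
    (h : Disjoint (hubbardTermSupp G Z) Y) : Commute (hubbardTermOp G t U μ Z) B :=
  commute_of_mem_carEvenSubalgebra_orbSet (hubbardTermOp_mem_carEvenSubalgebra G t U μ Z) hB h

open Literature.Probability.LatticeModels

variable (L : ℕ) [NeZero L]

/-- **The seam operator is even and supported on the seam**: `seamTwist L θ` lies in the even CAR algebra of any region
containing the two columns `x₁ = 0` and `x₁ = −1`. (Proved through the generic `sum₃_smul_hopping_mem_carEvenSubalgebra`, so that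
no instance of the concrete torus is re-synthesised.) [cite: Watanabe2019, §2.2.3 and §4.1] -/
theorem seamTwist_mem_carEvenSubalgebra (θ : ℝ) {X : Finset (FermionTorus 2 L)}
    (hX : ∀ y : ZMod L, FermionTorus.ofTorusSite (![0, y] : TorusSite 2 L) ∈ X ∧
      FermionTorus.ofTorusSite (![-1, y] : TorusSite 2 L) ∈ X) :
    seamTwist L θ ∈ carEvenSubalgebra (orbSet X) := by
  rw [seamTwist_eq]
  refine sum₃_smul_hopping_mem_carEvenSubalgebra
    (fun (_ : ZMod L) (_ : Fin 2) (b : Bool) => (1 - Complex.exp ((if b then 1 else -1) * Complex.I * θ)))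
    (fun y _ b => FermionTorus.ofTorusSite (![if b then 0 else -1, y] : TorusSite 2 L))
    (fun y _ b => FermionTorus.ofTorusSite (![if b then -1 else 0, y] : TorusSite 2 L))
    (fun _ σ _ => σ) (fun _ σ _ => σ) ?_ ?_
  · intro y σ b
    cases b
    · simpa using (hX y).2
    · simpa using (hX y).1
  · intro y σ b
    cases b
    · simpa using (hX y).1
    · simpa using (hX y).2

/-- `seamTwist L θ` conserves `(N↑, N↓)` in the entrywise shape of the line's `SectorPreserving L δ` (any `(2M, S^z = 0)` sector).
[cite: Watanabe2019, §2.2.3 and §4.1] -/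
theorem sectorPreserving_seamTwist (θ : ℝ) (M : ℕ) :
    ∀ s t : Finset (Orb (FermionTorus 2 L)),
      (s.card = 2 * M ∧ 2 * (s.filter fun i => (ofLex i).2 = 0).card = 2 * M) →
      ¬ (t.card = 2 * M ∧ 2 * (t.filter fun i => (ofLex i).2 = 0).card = 2 * M) →
      seamTwist L θ s t = 0 ∧ seamTwist L θ t s = 0 :=
  sectorPreserving_of_preservesSectors (preservesSectors_seamTwist L θ) M

/-- The flux torus Hamiltonian conserves `(N↑, N↓)` in the entrywise shape of the line's `SectorPreserving L δ`.
[cite: Watanabe2019, §2.2.3 and §4.1] -/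
theorem sectorPreserving_hubbardTorusTT'Flux (tp U θ : ℝ) (M : ℕ) :
    ∀ s t : Finset (Orb (FermionTorus 2 L)),
      (s.card = 2 * M ∧ 2 * (s.filter fun i => (ofLex i).2 = 0).card = 2 * M) →
      ¬ (t.card = 2 * M ∧ 2 * (t.filter fun i => (ofLex i).2 = 0).card = 2 * M) →
      hubbardTorusTT'Flux L tp U θ s t = 0 ∧ hubbardTorusTT'Flux L tp U θ t s = 0 :=
  sectorPreserving_of_preservesSectors (preservesSectors_hubbardTorusTT'Flux L tp U θ) M

end Parity

/-! ## §3 Sizes and the local-term presentation of the flux-free torus -/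

section Sizes

open scoped Matrix.Norms.L2Operator

variable {ι : Type*} [LinearOrder ι] [Fintype ι]

/-- `‖c†_i c_j‖ ≤ 1` in operator norm. Koma–Tasaki, PRL 68 (1992) 3248, after eq. (11). [folklore] -/
theorem norm_creation_mul_annihilation_le_one (i j : ι) :
    ‖(creation i * annihilation j : Matrix (Finset ι) (Finset ι) ℂ)‖ ≤ 1 :=
  (norm_mul_le _ _).trans (mul_le_one₀ (norm_creation_le_one _) (norm_nonneg _) (norm_annihilation_le_one _))

variable {Λ : Type*} [LinearOrder Λ] [Fintype Λ]

/-- The plain two-spin bond current has operator norm `≤ 4`. [folklore] -/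
theorem norm_farBond_le (a b : Λ) :
    ‖(∑ σ : Fin 2, ((-Complex.I) • (creation (orb a σ) * annihilation (orb b σ)) +
        Complex.I • (creation (orb b σ) * annihilation (orb a σ))) : Matrix (Finset (Orb Λ)) (Finset (Orb Λ)) ℂ)‖ ≤ 4 := by
  refine (norm_sum_le _ _).trans ?_
  have h2 : ∀ σ : Fin 2, ‖((-Complex.I) • (creation (orb a σ) * annihilation (orb b σ)) +
      Complex.I • (creation (orb b σ) * annihilation (orb a σ)) : Matrix (Finset (Orb Λ)) (Finset (Orb Λ)) ℂ)‖ ≤ 2 := by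
    intro σ
    refine (norm_add_le _ _).trans ?_
    rw [norm_smul, norm_smul, norm_neg, Complex.norm_I, one_mul, one_mul]
    linarith [norm_creation_mul_annihilation_le_one (orb a σ) (orb b σ),
      norm_creation_mul_annihilation_le_one (orb b σ) (orb a σ)]
  calc ∑ σ : Fin 2, ‖((-Complex.I) • (creation (orb a σ) * annihilation (orb b σ)) +
          Complex.I • (creation (orb b σ) * annihilation (orb a σ)) : Matrix (Finset (Orb Λ)) (Finset (Orb Λ)) ℂ)‖
      ≤ ∑ _σ : Fin 2, (2 : ℝ) := sum_le_sum fun σ _ => h2 σ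
    _ = 4 := by norm_num

open Literature.Probability.LatticeModels

variable (L : ℕ) [NeZero L]

/-- **The seam operator is flux-proportional**: `‖seamTwist L θ‖ ≤ 4L|θ|` (`4L` terms `(1 − e^{±iθ}) c†c`, each of norm `≤ |θ|`).
This is the `‖V_φ‖` entering the QBP factors `e^{O(β‖V_φ‖)}` of the port. [cite: Watanabe2019, §2.2.3 and §4.1] -/
theorem norm_seamTwist_le (θ : ℝ) : ‖seamTwist L θ‖ ≤ 4 * L * |θ| := by
  rw [seamTwist_eq]
  have hterm : ∀ (y : ZMod L) (σ : Fin 2) (b : Bool),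
      ‖(1 - Complex.exp ((if b then 1 else -1) * Complex.I * θ)) •
        (creation (orb (FermionTorus.ofTorusSite (![if b then 0 else -1, y] : TorusSite 2 L)) σ) *
          annihilation (orb (FermionTorus.ofTorusSite (![if b then -1 else 0, y] : TorusSite 2 L)) σ) :
          Matrix (Finset (Orb (FermionTorus 2 L))) (Finset (Orb (FermionTorus 2 L))) ℂ)‖ ≤ |θ| := by
    intro y σ b
    rw [norm_smul]
    exact (mul_le_mul (norm_one_sub_cexp_seamCoeff_le_abs θ b) (norm_creation_mul_annihilation_le_one _ _)
      (norm_nonneg _) (abs_nonneg _)).trans (by rw [mul_one])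
  have hb : ∀ (y : ZMod L) (σ : Fin 2), ‖∑ b : Bool, (1 - Complex.exp ((if b then 1 else -1) * Complex.I * θ)) •
        (creation (orb (FermionTorus.ofTorusSite (![if b then 0 else -1, y] : TorusSite 2 L)) σ) *
          annihilation (orb (FermionTorus.ofTorusSite (![if b then -1 else 0, y] : TorusSite 2 L)) σ) :
          Matrix (Finset (Orb (FermionTorus 2 L))) (Finset (Orb (FermionTorus 2 L))) ℂ)‖ ≤ 2 * |θ| := by
    intro y σ
    refine (norm_sum_le _ _).trans ?_
    calc _ ≤ ∑ _b : Bool, |θ| := sum_le_sum fun b _ => hterm y σ b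
      _ = 2 * |θ| := by simp [two_mul]
  have hσ : ∀ y : ZMod L, ‖∑ σ : Fin 2, ∑ b : Bool, (1 - Complex.exp ((if b then 1 else -1) * Complex.I * θ)) •
        (creation (orb (FermionTorus.ofTorusSite (![if b then 0 else -1, y] : TorusSite 2 L)) σ) *
          annihilation (orb (FermionTorus.ofTorusSite (![if b then -1 else 0, y] : TorusSite 2 L)) σ) :
          Matrix (Finset (Orb (FermionTorus 2 L))) (Finset (Orb (FermionTorus 2 L))) ℂ)‖ ≤ 4 * |θ| := by
    intro y
    refine (norm_sum_le _ _).trans ?_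
    calc _ ≤ ∑ _σ : Fin 2, 2 * |θ| := sum_le_sum fun σ _ => hb y σ
      _ = 4 * |θ| := by simp; ring
  refine (norm_sum_le _ _).trans ?_
  calc _ ≤ ∑ _y : ZMod L, 4 * |θ| := sum_le_sum fun y _ => hσ y
    _ = 4 * L * |θ| := by rw [sum_const, card_univ, ZMod.card, nsmul_eq_mul]; ring

/-- **The flux-free torus Hamiltonian is the sum of the tree's local terms** `hubbardTermOp (fermionTorusGraph 2 L) 1 U 0`
(symmetrised bond hoppings and on-site terms) — the presentation the Lieb–Robinson input of the port is stated over. [folklore] -/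
theorem hubbardTorusTT'Flux_zero_zero_eq_sum_hubbardTermOp (U : ℝ) :
    hubbardTorusTT'Flux L 0 U 0 = ∑ Z, hubbardTermOp (fermionTorusGraph 2 L) 1 U 0 Z := by
  rw [hubbardTorusTT'Flux_tPrime_zero, hubbardTorusFlux_zero, sum_hubbardTermOp, hamiltonianWith_zero]
  rfl

/-- The flux torus Hamiltonian at `t' = 0` splits as «local terms + seam operator». [folklore] -/
theorem hubbardTorusTT'Flux_zero_eq_sum_hubbardTermOp_add_seamTwist (U θ : ℝ) :
    hubbardTorusTT'Flux L 0 U θ = ∑ Z, hubbardTermOp (fermionTorusGraph 2 L) 1 U 0 Z + seamTwist L θ := by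
  rw [hubbardTorusTT'Flux_zero_eq_add_seamTwist, hubbardTorusTT'Flux_zero_zero_eq_sum_hubbardTermOp]

end Sizes

end Summit.Ventures.CertifiedManyBodySolver.Theorems.TcThermcert1.GaugeQbpFarSeam
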